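import Summits.NavierStokesRegularity.FluidComputer.TubeTablePost24
import HarnessLib

/-!
# Kernel run of the post-ramp box tube, chunks 0 … 5 (bp3 gen 16)

HONEST FRAMING: low prior, high value-of-information experiment on Tao's machine paradigm; NOT a
claim that NS blows up.

Kernel evaluations (`decide +kernel`; no `native_decide`, no extra axioms) of the in-tree tube checker
`runTube` (`P = 60`, 12 Taylor terms, cube `Rt`, read-out `CLt`) on the chunks `cP24 0 … cP24 5`
(= design chunks `cT 24 … cT 29`) of `TubeTablePost24.lean`, each from the recorded boundary
state `sP24 i` to `sP24 (i+1)`.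

[cite: Tao2016AveragedNS, §5.5 Thm 5.3 (5.5)]
-/

namespace Summit.NavierStokesRegularity.FluidComputer

namespace TubeTablePost24

open Literature.Analysis.FluidPDE.FluidComputer Literature.Analysis.FluidPDE.FluidComputer.TubeTable
open Literature.Analysis.FluidPDE.FluidComputer.ThresholdLevelTable (GIt)

set_option maxHeartbeats 10000000 in
set_option maxRecDepth 200000 in
/-- Chunk 0 of the post-ramp tube run (design chunk 24: 50 steps at `h = 2^-11`). [folklore] -/
theorem runP24_0 : runTube 60 12 GIt CLt Rt (sP24 0) (cP24 0) = some (sP24 (0 + 1)) := by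
  decide +kernel

set_option maxHeartbeats 10000000 in
set_option maxRecDepth 200000 in
/-- Chunk 1 of the post-ramp tube run (design chunk 25: 50 steps at `h = 2^-11`). [folklore] -/
theorem runP24_1 : runTube 60 12 GIt CLt Rt (sP24 1) (cP24 1) = some (sP24 (1 + 1)) := by
  decide +kernel

set_option maxHeartbeats 10000000 in
set_option maxRecDepth 200000 in
/-- Chunk 2 of the post-ramp tube run (design chunk 26: 50 steps at `h = 2^-11`). [folklore] -/
theorem runP24_2 : runTube 60 12 GIt CLt Rt (sP24 2) (cP24 2) = some (sP24 (2 + 1)) := by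
  decide +kernel

set_option maxHeartbeats 10000000 in
set_option maxRecDepth 200000 in
/-- Chunk 3 of the post-ramp tube run (design chunk 27: 50 steps at `h = 2^-11`). [folklore] -/
theorem runP24_3 : runTube 60 12 GIt CLt Rt (sP24 3) (cP24 3) = some (sP24 (3 + 1)) := by
  decide +kernel

set_option maxHeartbeats 10000000 in
set_option maxRecDepth 200000 in
/-- Chunk 4 of the post-ramp tube run (design chunk 28: 50 steps at `h = 2^-11`). [folklore] -/
theorem runP24_4 : runTube 60 12 GIt CLt Rt (sP24 4) (cP24 4) = some (sP24 (4 + 1)) := by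
  decide +kernel

set_option maxHeartbeats 10000000 in
set_option maxRecDepth 200000 in
/-- Chunk 5 of the post-ramp tube run (design chunk 29: 50 steps at `h = 2^-11`). [folklore] -/
theorem runP24_5 : runTube 60 12 GIt CLt Rt (sP24 5) (cP24 5) = some (sP24 (5 + 1)) := by
  decide +kernel

end TubeTablePost24

end Summit.NavierStokesRegularity.FluidComputer
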